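import Summits.ResolutionOfSingularities.ResolutionOfSingularities.Theorems.WeightedInvariantIota3IsoSucc
import Summits.ResolutionOfSingularities.ResolutionOfSingularities.Theorems.WeightedInvariantIota3FlagBridge
import HarnessLib

/-!
# (iso-succ), PART B′: re-flagging `g₁ ↦ a·g₁ + Φ(x, g₂)` inside the SAME filtration

W4.3 hypersurface-centre programme, crux `HypersurfaceCentreConstruction` (stmt-ResolutionOfSingularities-19897), local engine
(stmt-ResolutionOfSingularities-8899); ORDER (o42)(1) of res-L1-w43-plan-1, res-type-073 — the S-level form of (iso-succ) that PART C's
assembly consumes (memo `plan/tools/res-type-073/o42/P3B-PROOF-DESIGN.md` §2 (ii)–(iv)).  PART A (res-type-061, p533815) produces, from a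
hypothetical surface component `V(G)` of the multiplicity-`ν` locus of the initial form, `G = a·ḡ₁ + φ(x̄, ḡ₂)` with `in_w f = h₀·G^ν`; lifting
`φ` to `Φ ∈ S` gives a new first member `G₁ = a·g₁ + Φ` which DOMINATES AND IS DOMINATED BY `g₁` at level `r₁`, so by res-type-070's dominance
theorem (`flagContactFiltration_eq_of_mem_of_mem`, p533944) the flags `(G₁, g₂)` and `(g₁, g₂)` have the SAME `(q, r₁, r₂)`-filtration, and
PART B (`IsSigmaMaximiser.not_sub_pow_mem_succ_level`, p533685) forbids `f − c·G₁^ν ∈` level `r₁ν + 1` OF THE ORIGINAL FILTRATION: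
`IsSigmaMaximiser.not_sub_pow_mem_succ_level_reflag`.  The «first-member-free part» of level `r₁` (`⨆_β (g₂^β)·𝔪^⌈(r₁ − r₂β)/q⌉`, where the
lift `Φ` lives) lies in level `r₁` of EVERY flag with second member `g₂` (`freePart_le_flagContactFiltration`).

Folklore bookkeeping about OUR predicates; nothing here is a cited theorem.  [cite: AbramovichTemkinWlodarczyk2024, §5].
-/

open IsLocalRing
open Summit.ResolutionOfSingularities.ResolutionOfSingularities.Theorems

set_option linter.dupNamespace false -- mandated namespace of this single-conjunct summit

namespace Summit.ResolutionOfSingularities.ResolutionOfSingularities.Cruxes.HypersurfaceCentreConstruction.LocalEngine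

namespace Iota3

variable {S : Type} [CommRing S] [IsLocalRing S]

/-- **The first-member-free part of level `r₁`** — the pieces `(g₂^β)·𝔪^⌈(r₁ − r₂β)/q⌉` (no power of the first member) — lies in level
`r₁` of the filtration of `(h, g₂)` for EVERY first member `h`. [folklore] -/
theorem freePart_le_flagContactFiltration (h g₂ : S) (q r₁ r₂ : ℕ) :
    (⨆ β : ℕ, Ideal.span {g₂ ^ β} * maximalIdeal S ^ ((r₁ - r₂ * β + q - 1) / q)) ≤ flagContactFiltration h g₂ q r₁ r₂ r₁ := by
  refine iSup_le fun β => ?_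
  have hpiece := flagPiece_le h g₂ q r₁ r₂ r₁ 0 β
  rw [pow_zero, one_mul, mul_zero, Nat.sub_zero] at hpiece
  exact hpiece

/-- **Re-flagging by a dominant-and-dominated first member changes nothing**: for a σ-maximiser `(g₁, g₂; q, r₁, r₂)` of `f` at order
`ν ≥ 1` and a two-flag `(G₁, g₂)` with `G₁ ∈` level `r₁` of `(g₁, g₂)` and `g₁ ∈` level `r₁` of `(G₁, g₂)`, no `c` has `f − c·G₁^ν` in level
`r₁ν + 1` of the ORIGINAL filtration. [folklore] -/
theorem IsSigmaMaximiser.not_sub_pow_mem_succ_level_of_dominant {f : S} {ν : ℕ} {g₁ g₂ : S} {q r₁ r₂ : ℕ}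
    (hmax : IsSigmaMaximiser f ν g₁ g₂ q r₁ r₂) (hν : 0 < ν) {G₁ : S} (hG : IsTwoFlag G₁ g₂)
    (h₁ : G₁ ∈ flagContactFiltration g₁ g₂ q r₁ r₂ r₁) (h₁' : g₁ ∈ flagContactFiltration G₁ g₂ q r₁ r₂ r₁) (c : S) :
    f - c * G₁ ^ ν ∉ flagContactFiltration g₁ g₂ q r₁ r₂ (r₁ * ν + 1) := by
  have hq : 0 < q := hmax.1.1
  rw [← flagContactFiltration_eq_of_mem_of_mem hq h₁ (self_mem_flagContactFiltration g₁ g₂ r₁ r₂ hq).2 h₁'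
    (self_mem_flagContactFiltration G₁ g₂ r₁ r₂ hq).2 (r₁ * ν + 1)]
  exact hmax.not_sub_pow_mem_succ_level hν hG c

/-- **(iso-succ), S-level form.**  For a σ-maximiser `(g₁, g₂; q, r₁, r₂)` of `f` at order `ν ≥ 1`, a unit `a`, and `Φ` in the
first-member-free part of level `r₁` (the lift of PART A's `φ(x̄, ḡ₂)`), if `(a·g₁ + Φ, g₂)` is a two-flag then NO `c` has
`f − c·(a·g₁ + Φ)^ν` in level `r₁ν + 1` of the filtration of `(g₁, g₂)` — in words: the weighted initial form of `f` is not `h₀·(a·ḡ₁ + φ̄)^ν`.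
[folklore] -/
theorem IsSigmaMaximiser.not_sub_pow_mem_succ_level_reflag {f : S} {ν : ℕ} {g₁ g₂ : S} {q r₁ r₂ : ℕ}
    (hmax : IsSigmaMaximiser f ν g₁ g₂ q r₁ r₂) (hν : 0 < ν) {a Φ : S} (ha : IsUnit a)
    (hΦ : Φ ∈ ⨆ β : ℕ, Ideal.span {g₂ ^ β} * maximalIdeal S ^ ((r₁ - r₂ * β + q - 1) / q)) (hG : IsTwoFlag (a * g₁ + Φ) g₂) (c : S) :
    f - c * (a * g₁ + Φ) ^ ν ∉ flagContactFiltration g₁ g₂ q r₁ r₂ (r₁ * ν + 1) := by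
  have hq : 0 < q := hmax.1.1
  obtain ⟨a, rfl⟩ := ha
  refine hmax.not_sub_pow_mem_succ_level_of_dominant hν hG ?_ ?_ c
  · exact add_mem (Ideal.mul_mem_left _ _ (self_mem_flagContactFiltration g₁ g₂ r₁ r₂ hq).1)
      (freePart_le_flagContactFiltration g₁ g₂ q r₁ r₂ hΦ)
  · have h2 : (↑a * g₁ + Φ) - Φ ∈ flagContactFiltration (↑a * g₁ + Φ) g₂ q r₁ r₂ r₁ :=
      sub_mem (self_mem_flagContactFiltration _ g₂ r₁ r₂ hq).1 (freePart_le_flagContactFiltration _ g₂ q r₁ r₂ hΦ)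
    rw [add_sub_cancel_right] at h2
    have h3 := Ideal.mul_mem_left _ (↑a⁻¹ : S) h2
    rwa [← mul_assoc, Units.inv_mul, one_mul] at h3

end Iota3

end Summit.ResolutionOfSingularities.ResolutionOfSingularities.Cruxes.HypersurfaceCentreConstruction.LocalEngine
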